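import Summits.CriticalPhenomena.CardyFormulaZ2.Theorems.CardySusyWardDiscretisationFamilyExistsExitGeom
import HarnessLib

/-!
# The exit arc of a leg, II: the arc — helper for `DiscretisationFamilyExists` (stmt-CriticalPhenomena-9644)

Continuation of `…ExistsExitGeom` (same vocabulary).  `exists_exitArc`: for an inner cell `F` and a
side-adjacent non-inner cell `F'` (regular `Ω`), a frontier point `c ∈ closure F'` and a simple arc
`X` from the centre `C` of `F` to `c` with `X \ {c} ⊆ Ω`, `segment C P* ⊆ X ⊆ segment C C' ∪
closure F'` (`P*` the midpoint of the common side, `C'` the centre of `F'`), every point of `X` in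
`Ω` lying on `segment C P*` or in the OPEN cell `F'`.  Proof: first hit of `Ωᶜ ∪ {C'}` along
`[C, C']` (before parameter `1/2` the path is in the open inner cell); either that hit is off `Ω`
(then `X` is a segment), or the whole of `[C, C']` is in `Ω` and the first hit of `Ωᶜ` along
`[C', w]`, `w` an exit witness of `F'`, ends the arc (`IsSimpleArc.union`, the two pieces meeting
only in `C'` by `segment_inter_segment_witness`).
-/

noncomputable section

open Set Metric Complex
open Literature.Probability.LatticeModels Literature.Probability.Percolation
  Literature.Probability.LatticeModels.Mesh Literature.Probability.LatticeModels.DiscreteDobrushin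
  Literature.Topology.PlaneTopology

namespace Summit.CriticalPhenomena.CardyFormulaZ2.Theorems.DiscretisationFamilyExists

/-- **Exit witness, with its nature recorded**: as `exists_exitWitness`, and moreover the
witness is off `closure Ω` (a side point) or is a mesh point (a corner). [folklore] -/
theorem exists_exitWitness' {E : DiscreteDobrushin} (hΩ : IsOpen E.Ω)
    (hJE : frontier E.Ω ⊆ closure (closure E.Ω)ᶜ) (hext : IsConnected (closure E.Ω)ᶜ)
    (hunb : ¬ Bornology.IsBounded (closure E.Ω)ᶜ) (hδ : 0 < E.δ) {k j k' j' : ℤ}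
    (hF : E.IsInnerFace ![k, j]) (hF' : ¬ E.IsInnerFace ![k', j'])
    (hadj : (k' = k ∧ (j' = j + 1 ∨ j' = j - 1)) ∨ (j' = j ∧ (k' = k + 1 ∨ k' = k - 1))) :
    ∃ w : ℂ, w ∈ closure (cell E.δ k' j') ∧ w ∉ E.Ω ∧ w ∈ gridLines E.δ ∧
      w ≠ (2⁻¹ : ℝ) • (cellCenter E.δ k j + cellCenter E.δ k' j') ∧
      (w ∉ closure E.Ω ∨ ∃ x : Site 2, w = meshPoint E.δ x) := by
  set δ := E.δ with hδdef
  have hcorner : ∃ x₀ : Site 2, IsCorner x₀ ![k, j] ∧ IsCorner x₀ ![k', j'] := by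
    rcases hadj with ⟨hk, hj | hj⟩ | ⟨hj, hk | hk⟩
    · refine ⟨![k, j + 1], ?_, ?_⟩ <;> intro i <;> fin_cases i <;> simp <;> omega
    · refine ⟨![k, j], ?_, ?_⟩ <;> intro i <;> fin_cases i <;> simp <;> omega
    · refine ⟨![k + 1, j], ?_, ?_⟩ <;> intro i <;> fin_cases i <;> simp <;> omega
    · refine ⟨![k, j], ?_, ?_⟩ <;> intro i <;> fin_cases i <;> simp <;> omega
  obtain ⟨x₀, hx₀F, hx₀F'⟩ := hcorner
  have hx₀D : x₀ ∈ meshDomain E.Ω δ := by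
    obtain ⟨a, b, rfl⟩ := exists_corner_eq_of_isCorner hx₀F
    have hadj' : (zdGraph 2).Adj (corner ((![k, j] : Site 2) 0) ((![k, j] : Site 2) 1) a b)
        (corner ((![k, j] : Site 2) 0) ((![k, j] : Site 2) 1) (!a) b) := by
      cases a
      · exact zdGraph_adj_corner_horizontal _ _ b
      · exact (zdGraph_adj_corner_horizontal _ _ b).symm
    exact (discreteDomainGraph_adj_iff.1
      (hF _ _ (isCorner_corner _ a b) (isCorner_corner _ (!a) b) hadj')).2.1
  have hPcl : (2⁻¹ : ℝ) • (cellCenter δ k j + cellCenter δ k' j') ∈ closure E.Ω :=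
    closure_cell_subset_of_isInnerFace hΩ hJE hext hunb hδ hF
      (by simpa using (midpoint_mem_closure_of_adj hδ hadj).1)
  rcases exists_witness_of_not_isInnerFace hF' hx₀F' hx₀D with ⟨v, w, hv, hw, hvw, hseg⟩ | ⟨u, hu, huV⟩
  · obtain ⟨z, hz, hzcl⟩ := not_subset.1 hseg
    obtain ⟨a, b, rfl⟩ := exists_corner_eq_of_isCorner hv
    obtain ⟨a', b', rfl⟩ := exists_corner_eq_of_isCorner hw
    refine ⟨z, ?_, fun h => hzcl (subset_closure h), segment_meshPoint_subset_gridLines δ hvw hz,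
      fun h => hzcl (h ▸ hPcl), Or.inl hzcl⟩
    have := segment_corner_subset_closure_cell hδ k' j' a b a' b'
    simp only [Matrix.cons_val_zero, Matrix.cons_val_one] at hz
    exact this (by simpa using hz)
  · obtain ⟨a, b, rfl⟩ := exists_corner_eq_of_isCorner hu
    refine ⟨meshPoint δ (corner ((![k', j'] : Site 2) 0) ((![k', j'] : Site 2) 1) a b), ?_, huV,
      meshPoint_mem_gridLines δ _, meshPoint_ne_midpoint_of_adj hδ hadj _, Or.inr ⟨_, rfl⟩⟩
    simpa using meshPoint_corner_mem_closure_cell hδ k' j' a b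

/-- **The exit arc.** `F = (k, j)` inner, `F' = (k', j')` a side-adjacent non-inner cell, `C`, `C'`
their centres, `P* = (C + C')/2` the midpoint of the common side (regular `Ω`, `δ > 0`).  There is
a frontier point `c ∈ closure F'` and a simple arc `X` from `C` to `c` with `X \ {c} ⊆ Ω`,
`segment C P* ⊆ X ⊆ segment C C' ∪ closure F'`, every point of `X` in `Ω` lying on
`segment C P*` or in the open cell `F'`. [folklore] -/
theorem exists_exitArc {E : DiscreteDobrushin} (hΩ : IsOpen E.Ω)
    (hJE : frontier E.Ω ⊆ closure (closure E.Ω)ᶜ) (hext : IsConnected (closure E.Ω)ᶜ)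
    (hunb : ¬ Bornology.IsBounded (closure E.Ω)ᶜ) (hδ : 0 < E.δ) {k j k' j' : ℤ}
    (hF : E.IsInnerFace ![k, j]) (hF' : ¬ E.IsInnerFace ![k', j'])
    (hadj : (k' = k ∧ (j' = j + 1 ∨ j' = j - 1)) ∨ (j' = j ∧ (k' = k + 1 ∨ k' = k - 1))) :
    ∃ c ∈ frontier E.Ω, ∃ X : Set ℂ,
      IsSimpleArc X (cellCenter E.δ k j) c ∧ X \ {c} ⊆ E.Ω ∧
      segment ℝ (cellCenter E.δ k j) ((2⁻¹ : ℝ) • (cellCenter E.δ k j + cellCenter E.δ k' j')) ⊆ X ∧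
      X ⊆ segment ℝ (cellCenter E.δ k j) (cellCenter E.δ k' j') ∪ closure (cell E.δ k' j') ∧
      c ∈ closure (cell E.δ k' j') ∧
      (∀ z ∈ X, z ∈ E.Ω → z ∈ segment ℝ (cellCenter E.δ k j) ((2⁻¹ : ℝ) • (cellCenter E.δ k j + cellCenter E.δ k' j')) ∨
        z ∈ cell E.δ k' j') ∧
      (c = (2⁻¹ : ℝ) • (cellCenter E.δ k j + cellCenter E.δ k' j') ∨ c ∈ cell E.δ k' j' ∨
        ∃ x : Site 2, c = meshPoint E.δ x) := by
  obtain ⟨hPF, hPF', hdir⟩ := midpoint_mem_closure_of_adj hδ hadj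
  have hw := exists_exitWitness' hΩ hJE hext hunb hδ hF hF' hadj
  have hgridP := fun z => eq_midpoint_of_mem_segment_of_mem_gridLines (δ := E.δ) hδ hadj (z := z)
  set δ := E.δ with hδdef
  set C := cellCenter δ k j with hC
  set C' := cellCenter δ k' j' with hC'
  set Pstar := (2⁻¹ : ℝ) • (C + C') with hP
  have hCF : C ∈ cell δ k j := cellCenter_mem_cell hδ k j
  have hC'F' : C' ∈ cell δ k' j' := cellCenter_mem_cell hδ k' j'
  have hfull : cell δ k j ⊆ E.Ω := isFull_of_isInnerFace hΩ hJE hext hunb hδ hF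
  have hCΩ : C ∈ E.Ω := hfull hCF
  have hdisj := closure_cell_disjoint_cell_of_adj hδ hadj
  have hCC' : C ≠ C' := fun h => Set.disjoint_left.1 hdisj (subset_closure hCF) (h ▸ hC'F')
  -- the two halves of the segment `[C, C']`
  have hleft : ∀ θ : ℝ, 0 ≤ θ → θ < 1 / 2 → C + θ • (C' - C) ∈ cell δ k j := by
    intro θ h0 h1
    rcases eq_or_lt_of_le h0 with rfl | h0'
    · simpa using hCF
    · rw [param_eq_param_midpoint]
      refine openSegment_subset_cell_of_mem_closure k j hCF hPF ?_
      rw [openSegment_eq_image]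
      refine ⟨2 * θ, ⟨by linarith, by linarith⟩, ?_⟩
      show (1 - 2 * θ) • C + (2 * θ) • Pstar = C + (2 * θ) • (Pstar - C)
      rw [smul_sub, sub_smul, one_smul]; abel
  have hright : ∀ θ : ℝ, 1 / 2 < θ → θ ≤ 1 → C + θ • (C' - C) ∈ cell δ k' j' := by
    intro θ h0 h1
    rcases eq_or_lt_of_le h1 with rfl | h1'
    · simpa using hC'F'
    · rw [param_eq_param_midpoint']
      refine openSegment_subset_cell_of_mem_closure k' j' hC'F' hPF' ?_
      rw [openSegment_eq_image]
      refine ⟨2 * (1 - θ), ⟨by linarith, by linarith⟩, ?_⟩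
      show (1 - 2 * (1 - θ)) • C' + (2 * (1 - θ)) • Pstar = C' + (2 * (1 - θ)) • (Pstar - C')
      rw [smul_sub, sub_smul, one_smul]; abel
  have hhalf : C + (1 / 2 : ℝ) • (C' - C) = Pstar := by
    rw [hP]; simp only [Complex.real_smul]; push_cast; ring
  have hsegP : segment ℝ C Pstar = (fun θ : ℝ => C + θ • (C' - C)) '' Icc 0 (1 / 2) := by
    rw [image_param_Icc C C' (by norm_num : (0:ℝ) ≤ 1 / 2), hhalf]
  -- first hit of `Ωᶜ ∪ {C'}` along `[C, C']`
  set η₁ : ℝ → ℂ := fun θ => C + θ • (C' - C) with hη₁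
  have hη₁c : Continuous η₁ := continuous_param C C'
  have hη₁i : Function.Injective η₁ := injective_param hCC'
  have hK : IsClosed (E.Ωᶜ ∪ {C'}) := hΩ.isClosed_compl.union isClosed_singleton
  have h0 : η₁ 0 ∉ E.Ωᶜ ∪ {C'} := by
    have : η₁ 0 = C := by simp [hη₁]
    rw [this]; rintro (h | h)
    · exact h hCΩ
    · exact hCC' h
  have h1 : η₁ 1 ∈ E.Ωᶜ ∪ {C'} := Or.inr (by simp [hη₁])
  obtain ⟨t₁, ⟨ht₁0, ht₁1⟩, ht₁K, hbefore⟩ := exists_first_hit hη₁c.continuousOn hK h0 h1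
  -- `t₁ ≥ 1/2`: before `1/2` the path is in the inner cell
  have ht₁half : 1 / 2 ≤ t₁ := by
    by_contra h
    push Not at h
    have hin := hleft t₁ ht₁0.le h
    rcases ht₁K with h' | h'
    · exact h' (hfull hin)
    · have e : C + t₁ • (C' - C) = C' := Set.mem_singleton_iff.1 h'
      rw [e] at hin
      exact Set.disjoint_left.1 hdisj (subset_closure hin) hC'F'
  have hbef : ∀ θ : ℝ, 0 ≤ θ → θ < t₁ → η₁ θ ∈ E.Ω := by
    intro θ h0 h1
    have := hbefore θ ⟨h0, h1⟩
    simp only [mem_union, mem_compl_iff, mem_singleton_iff, not_or, not_not] at this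
    exact this.1
  have hsegP' : segment ℝ C Pstar = η₁ '' Icc 0 (1 / 2) := hsegP
  by_cases hout : η₁ t₁ ∈ E.Ω
  swap
  · ----------------------------------------------------------------
    -- Case (a): the first hit `c = η₁ t₁` is off `Ω`: the exit arc is the segment `[C, c]`
    set c := η₁ t₁ with hc
    have hX : η₁ '' Icc 0 t₁ = segment ℝ C c := by
      rw [hη₁, image_param_Icc C C' ht₁0.le]
    have hcC : C ≠ c := fun h => hout (h ▸ hCΩ)
    have hc_cl : c ∈ closure E.Ω :=
      mem_closure_of_before hη₁c ht₁0 fun θ hθ => hbef θ hθ.1 hθ.2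
    have hc_fr : c ∈ frontier E.Ω := mem_frontier_of_not_mem_of_mem_closure hΩ hout hc_cl
    have hcF' : c ∈ closure (cell δ k' j') := by
      rcases eq_or_lt_of_le ht₁half with h | h
      · have : c = Pstar := by rw [hc, hη₁]; beta_reduce; rw [← h]; exact hhalf
        rw [this]; exact hPF'
      · exact subset_closure (hright t₁ h ht₁1)
    have hc_cases : c = Pstar ∨ c ∈ cell δ k' j' ∨ ∃ x : Site 2, c = meshPoint δ x := by
      rcases eq_or_lt_of_le ht₁half with h | h
      · left; rw [hc, hη₁]; beta_reduce; rw [← h]; exact hhalf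
      · exact Or.inr (Or.inl (hright t₁ h ht₁1))
    refine ⟨c, hc_fr, segment ℝ C c, IsSimpleArc.segment hcC, ?_, ?_, ?_, hcF', ?_, hc_cases⟩
    · rintro z ⟨hz, hzc⟩
      rw [← hX] at hz
      obtain ⟨θ, ⟨h0, h1⟩, rfl⟩ := hz
      have hne : θ ≠ t₁ := fun h => hzc (by rw [mem_singleton_iff, h])
      exact hbef θ h0 (lt_of_le_of_ne h1 hne)
    · rw [hsegP', ← hX]
      exact image_mono (Icc_subset_Icc_right ht₁half)
    · intro z hz
      left
      rw [← hX] at hz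
      obtain ⟨θ, ⟨h0, h1⟩, rfl⟩ := hz
      rw [segment_eq_image']
      exact ⟨θ, ⟨h0, h1.trans ht₁1⟩, rfl⟩
    · intro z hz hzΩ
      rw [← hX] at hz
      obtain ⟨θ, ⟨h0, h1⟩, rfl⟩ := hz
      by_cases hθ : θ ≤ 1 / 2
      · left; rw [hsegP']; exact ⟨θ, ⟨h0, hθ⟩, rfl⟩
      · right; push Not at hθ; exact hright θ hθ (h1.trans ht₁1)
  · ----------------------------------------------------------------
    -- Case (b): the whole segment `[C, C']` lies in `Ω`; exit through the witness of `F'`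
    have heq : η₁ t₁ = C' := by
      rcases ht₁K with h | h
      · exact absurd hout h
      · exact h
    have hC'Ω : C' ∈ E.Ω := heq ▸ hout
    have ht₁1' : t₁ = 1 := hη₁i (heq.trans (by simp [hη₁]))
    have hsegΩ : segment ℝ C C' ⊆ E.Ω := by
      intro z hz
      rw [segment_eq_image'] at hz
      obtain ⟨θ, ⟨h0, h1⟩, rfl⟩ := hz
      rcases eq_or_lt_of_le h1 with h | h1'
      · rw [h]; simpa using hC'Ω
      · exact hbef θ h0 (ht₁1' ▸ h1')
    obtain ⟨w, hwF', hwΩ, hwgrid, hwP, hwnat⟩ := hw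
    have hwcell : w ∉ cell δ k' j' := fun h => cell_subset_compl_gridLines hδ k' j' h hwgrid
    have hC'w : C' ≠ w := fun h => hwΩ (h ▸ hC'Ω)
    set η₂ : ℝ → ℂ := fun θ => C' + θ • (w - C') with hη₂
    have hη₂c : Continuous η₂ := continuous_param C' w
    have h0' : η₂ 0 ∉ E.Ωᶜ := by simp [hη₂, hC'Ω]
    have h1' : η₂ 1 ∈ E.Ωᶜ := by simp [hη₂, hwΩ]
    obtain ⟨t₂, ⟨ht₂0, ht₂1⟩, ht₂K, hbefore₂⟩ := exists_first_hit hη₂c.continuousOn hΩ.isClosed_compl h0' h1'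
    set c := η₂ t₂ with hc
    have hout₂ : c ∉ E.Ω := ht₂K
    have hbef₂ : ∀ θ : ℝ, 0 ≤ θ → θ < t₂ → η₂ θ ∈ E.Ω := fun θ h0 h1 => by
      have := hbefore₂ θ ⟨h0, h1⟩; rwa [mem_compl_iff, not_not] at this
    have hX₂ : η₂ '' Icc 0 t₂ = segment ℝ C' c := by
      rw [hη₂, image_param_Icc C' w ht₂0.le]
    have hcC' : C' ≠ c := fun h => hout₂ (h ▸ hC'Ω)
    have hc_cl : c ∈ closure E.Ω :=
      mem_closure_of_before hη₂c ht₂0 fun θ hθ => hbef₂ θ hθ.1 hθ.2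
    have hc_fr : c ∈ frontier E.Ω := mem_frontier_of_not_mem_of_mem_closure hΩ hout₂ hc_cl
    -- `[C', c] ⊆ [C', w] ⊆ closure F'`, and points of `[C', w)` are in the open cell
    have hsub_w : segment ℝ C' c ⊆ segment ℝ C' w := by
      rw [← hX₂]
      rintro _ ⟨θ, ⟨h0, h1⟩, rfl⟩
      rw [segment_eq_image']
      exact ⟨θ, ⟨h0, h1.trans ht₂1⟩, rfl⟩
    have hsegw_cl : segment ℝ C' w ⊆ closure (cell δ k' j') :=
      (convex_cell δ k' j').closure.segment_subset (subset_closure hC'F') hwF'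
    have hcF' : c ∈ closure (cell δ k' j') := hsegw_cl (hsub_w (right_mem_segment _ _ _))
    have hopen_w : ∀ θ : ℝ, 0 ≤ θ → θ < 1 → η₂ θ ∈ cell δ k' j' := by
      intro θ h0 h1
      rcases eq_or_lt_of_le h0 with h | h0'
      · rw [← h]; simpa [hη₂] using hC'F'
      · refine openSegment_subset_cell_of_mem_closure k' j' hC'F' hwF' ?_
        rw [openSegment_eq_image]
        refine ⟨θ, ⟨h0', h1⟩, ?_⟩
        show (1 - θ) • C' + θ • w = C' + θ • (w - C')
        rw [smul_sub, sub_smul, one_smul]; abel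
    have hinter : segment ℝ C C' ∩ segment ℝ C' c ⊆ {C'} := fun z hz =>
      segment_inter_segment_witness hδ hadj hwF' hwgrid hwP ⟨hz.1, hsub_w hz.2⟩
    have hc_cases : c = Pstar ∨ c ∈ cell δ k' j' ∨ ∃ x : Site 2, c = meshPoint δ x := by
      rcases eq_or_lt_of_le ht₂1 with h | h
      · -- `c = w`: `w` is in `closure Ω` (as a frontier point), so it is a mesh point
        have hcw : c = w := by rw [hc, h]; simp [hη₂]
        rcases hwnat with h' | h'
        · exact absurd (hcw ▸ hc_cl) h'
        · exact Or.inr (Or.inr (hcw ▸ h'))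
      · exact Or.inr (Or.inl (hopen_w t₂ ht₂0.le h))
    refine ⟨c, hc_fr, segment ℝ C C' ∪ segment ℝ C' c,
      (IsSimpleArc.segment hCC').union (IsSimpleArc.segment hcC') hinter, ?_, ?_, ?_, hcF', ?_, hc_cases⟩
    · rintro z ⟨hz | hz, hzc⟩
      · exact hsegΩ hz
      · rw [← hX₂] at hz
        obtain ⟨θ, ⟨h0, h1⟩, rfl⟩ := hz
        have hne : θ ≠ t₂ := fun h => hzc (by rw [mem_singleton_iff, h])
        exact hbef₂ θ h0 (lt_of_le_of_ne h1 hne)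
    · refine subset_union_of_subset_left ?_ _
      rw [hsegP', segment_eq_image']
      exact image_mono (Icc_subset_Icc_right (by norm_num))
    · exact union_subset_union_right _ ((hsub_w.trans hsegw_cl))
    · rintro z (hz | hz) hzΩ
      · rw [segment_eq_image'] at hz
        obtain ⟨θ, ⟨h0, h1⟩, rfl⟩ := hz
        by_cases hθ : θ ≤ 1 / 2
        · left; rw [hsegP']; exact ⟨θ, ⟨h0, hθ⟩, rfl⟩
        · right; push Not at hθ; exact hright θ hθ h1
      · right
        rw [← hX₂] at hz
        obtain ⟨θ, ⟨h0, h1⟩, rfl⟩ := hz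
        have hθ1 : θ < 1 := by
          refine lt_of_le_of_ne (h1.trans ht₂1) fun h => hwΩ ?_
          have : η₂ θ = w := by rw [h]; simp [hη₂]
          rwa [this] at hzΩ
        exact hopen_w θ h0 hθ1

end Summit.CriticalPhenomena.CardyFormulaZ2.Theorems.DiscretisationFamilyExists

end
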